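import Literature.NumberTheory.EllipticCurves.DivisionTowerH1VanishingOfHomothetyProofs
import HarnessLib

/-!
# `#ker (H¹(G, M) → H¹(N, M)) ≤ 2`, an abstract criterion modelled on `GL₂(ℤ/2^k)` — PART 1:
# normalisation to `M[2]`-valued cocycles and vanishing on the stabiliser of `M[2]`
# (Lawson–Wuthrich 2016 at the even prime; Sah's lemma with the homothety `3`)

`Proofs`-style file (THEOREMS ONLY).  Abstract group-cohomology criterion, in the tree's model of
inflation (`cocyclesVanishingOn`, `inflClass`, `subgroupResKer`), for the ORDER of the restriction
kernel `H¹(G/N, M)` to be at most `2`.  The hypotheses are exactly the features of `G/N = GL₂(ℤ/2^k)`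
acting on `M = (ℤ/2^k)²` used by the hand computation `H¹(GL₂(ℤ/2^k), (ℤ/2^k)²) ↪ 𝔽₂`:
a central element `z` acting as the homothety `3` (Sah: `2 · H¹ = 0` and, after a coboundary change,
cocycles are `M[2]`-valued), two "transvections" `t, t'` and a "swap" `s` with prescribed action on the
four-element group `M[2] = {0, E₁, E₂, E₁ + E₂}`, a "diagonal" family `d` normalised by `t, t'` up to
powers of `u = t²`, `l = t'²`, and the generation of the stabiliser of `M[2]` by `u, l, d` modulo `N`
(the `LDU` decomposition of `Γ(2)`).  This part: Step 1 (Sah + halving: every class has an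
`M[2]`-valued representative, `Rubin1987.exists_two_zsmul_apply_eq_zero`), Steps 2–4 (such a cocycle
restricted to the stabiliser `G_V` of `V = M[2]` is an equivariant homomorphism, and it VANISHES on `G_V`
as soon as it vanishes at `t²`, `Rubin1987.apply_eq_zero_of_mem_fixingSubgroup_of_apply_mul_self_eq_zero`).
Part 2 (`DivisionTowerH1OrderTwoCriterion`) concludes `Nat.card ≤ 2`; a further companion discharges the
hypotheses for an elliptic curve with surjective `ρ̄_{E,2^k}`.  «beyond-print theorem»: no (finite group cohomology; Lawson–Wuthrich 2016
§7.1 report the `p = 2` groups numerically).  BSD is NOT proved by this file.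

References: T. Lawson, C. Wuthrich, *Vanishing of some Galois cohomology groups for elliptic curves*
(2016), Lemma 3, §7.1 [LawsonWuthrich2016]; C.-H. Sah, J. Algebra 10 (1968), Prop. 2.7 (b) [Sah1968];
J.-P. Serre, *Galois Cohomology*, I.§5.8 [SerreGaloisCohomology1997].
-/

set_option autoImplicit false

noncomputable section

open scoped Classical

open Literature.NumberTheory.GaloisRepresentations

universe u

namespace Literature.NumberTheory.EllipticCurves

namespace Rubin1987

section OrderTwoAlgebra

variable {G : Type u} [Group G] {M : Type u} [AddCommGroup M] [DistribMulAction G M]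
variable {N : Subgroup G}

/-! #### Step 1: a coboundary change making the cocycle `M[2]`-valued -/

/-- A coboundary `g ↦ g • w − w` of an `N`-INVARIANT `w` is a crossed homomorphism vanishing on `N`.
[folklore] -/
private theorem coboundary_mem (w : M) (hw : ∀ n ∈ N, n • w = w) :
    (fun g : G ↦ g • w - w) ∈ cocyclesVanishingOn M N := by
  refine ⟨fun g h ↦ ?_, fun n hn ↦ by simp only [hw n hn, sub_self]⟩
  simp only [mul_smul, smul_sub]
  abel

/-- Sah's identity modulo `N` for the homothety `3`: `2 • f g = g • f z − f z`.
[cite: Sah1968, Prop. 2.7 (b)] -/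
private theorem two_zsmul_apply_eq_of_three (f : cocyclesVanishingOn M N) {z : G}
    (hzc : ∀ g : G, ∃ n ∈ N, z * g = g * z * n) (hz : ∀ x : M, z • x = (3 : ℤ) • x) (g : G) :
    (2 : ℤ) • f.1 g = g • f.1 z - f.1 z := by
  obtain ⟨n, hn, hc⟩ := hzc g
  have h1 : f.1 (z * g) = f.1 z + z • f.1 g := cocyclesVanishingOn.cocycle f z g
  have h2 : f.1 (g * z * n) = f.1 g + g • f.1 z := by
    rw [cocyclesVanishingOn.apply_mul_of_mem f _ hn, cocyclesVanishingOn.cocycle f g z]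
  rw [hc] at h1
  have h3 : f.1 z + z • f.1 g = f.1 g + g • f.1 z := h1.symm.trans h2
  rw [hz] at h3
  have h4 : (3 : ℤ) • f.1 g - f.1 g = g • f.1 z - f.1 z := by
    rw [sub_eq_sub_iff_add_eq_add, add_comm ((3 : ℤ) • f.1 g), h3, add_comm]
  rw [show (2 : ℤ) = 3 - 1 by norm_num, sub_smul, one_smul]
  exact h4

/-- **Normalisation (Sah with the homothety `3`, then halving).** Let `N` act trivially on `M`, let
`z` be central modulo `N` and act on `M` as `3`, and let `t, t' ∈ G` have the HALVING property: an
`x ∈ M` with `t x − x ∈ 2M` and `t' x − x ∈ 2M` lies in `2M` (for `GL₂(ℤ/2^k)`: the two transvections).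
Then every crossed homomorphism `f` vanishing on `N` is cohomologous (by the coboundary of some `w`)
to one with values in `M[2]`: Sah gives `2 f(g) = g f(z) − f(z)`, halving gives `f(z) = 2w`, and
`f − ∂w` kills `z`. [cite: Sah1968, Prop. 2.7 (b)] [cite: LawsonWuthrich2016, Lemma 3] -/
theorem exists_two_zsmul_apply_eq_zero (hNM : ∀ n ∈ N, ∀ x : M, n • x = x)
    (f : cocyclesVanishingOn M N) {z : G} (hzc : ∀ g : G, ∃ n ∈ N, z * g = g * z * n)
    (hz : ∀ x : M, z • x = (3 : ℤ) • x) {t t' : G}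
    (hhalf : ∀ x : M, (∃ y : M, t • x - x = (2 : ℤ) • y) → (∃ y : M, t' • x - x = (2 : ℤ) • y) →
      ∃ w : M, x = (2 : ℤ) • w) :
    ∃ (w : M) (f' : cocyclesVanishingOn M N), (∀ g, f'.1 g = f.1 g - (g • w - w)) ∧
      ∀ g, (2 : ℤ) • f'.1 g = 0 := by
  have hsah : ∀ g : G, (2 : ℤ) • f.1 g = g • f.1 z - f.1 z :=
    two_zsmul_apply_eq_of_three f hzc hz
  obtain ⟨w, hw⟩ := hhalf (f.1 z) ⟨f.1 t, (hsah t).symm⟩ ⟨f.1 t', (hsah t').symm⟩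
  refine ⟨w, ⟨fun g ↦ f.1 g - (g • w - w), (cocyclesVanishingOn M N).sub_mem f.2
    (coboundary_mem w fun n hn ↦ hNM n hn w)⟩, fun g ↦ rfl, fun g ↦ ?_⟩
  change (2 : ℤ) • (f.1 g - (g • w - w)) = 0
  rw [smul_sub, hsah g, hw, smul_sub, smul_comm g (2 : ℤ) w, sub_self]

/-! #### Step 2: an `M[2]`-valued crossed homomorphism restricted to the stabiliser of `M[2]` -/

/-- On the stabiliser `G_V` of `V = M[2]` an `M[2]`-valued crossed homomorphism is ADDITIVE.
[folklore] -/
private theorem apply_mul_of_mem_fixingSubgroup (f : cocyclesVanishingOn M N) (hfV : ∀ g, (2 : ℤ) • f.1 g = 0)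
    {a : G} (ha : a ∈ fixingSubgroup G {v : M | (2 : ℤ) • v = 0}) (b : G) :
    f.1 (a * b) = f.1 a + f.1 b := by
  rw [cocyclesVanishingOn.cocycle f, (mem_fixingSubgroup_iff G).1 ha _ (hfV b)]

/-- … and `G`-EQUIVARIANT for conjugation: `f (g a g⁻¹) = g • f a` for `a ∈ G_V`. [folklore] -/
private theorem apply_conj_of_mem_fixingSubgroup (f : cocyclesVanishingOn M N)
    (hfV : ∀ g, (2 : ℤ) • f.1 g = 0) {a : G} (ha : a ∈ fixingSubgroup G {v : M | (2 : ℤ) • v = 0})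
    (g : G) : f.1 (g * a * g⁻¹) = g • f.1 a := by
  have h1 : f.1 (g * a * g⁻¹) = f.1 g + g • f.1 a + g • f.1 g⁻¹ := by
    rw [cocyclesVanishingOn.cocycle f, cocyclesVanishingOn.cocycle f, mul_smul,
      (mem_fixingSubgroup_iff G).1 ha _ (hfV g⁻¹), add_assoc]
  have h2 : f.1 g + g • f.1 g⁻¹ = 0 := by
    rw [← cocyclesVanishingOn.cocycle f, mul_inv_cancel]
    have h := cocyclesVanishingOn.cocycle f (1 : G) 1
    rw [mul_one, one_smul, left_eq_add] at h
    exact h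
  rw [h1, add_comm (f.1 g), add_assoc, h2, add_zero]

/-- An `M[2]`-valued crossed homomorphism vanishing on a subset `S ⊆ G_V` vanishes on the subgroup
generated by `S`. [folklore] -/
private theorem apply_eq_zero_of_mem_closure (f : cocyclesVanishingOn M N) (hfV : ∀ g, (2 : ℤ) • f.1 g = 0)
    {S : Set G} (hSV : S ⊆ fixingSubgroup G {v : M | (2 : ℤ) • v = 0}) (hS : ∀ a ∈ S, f.1 a = 0)
    {w : G} (hw : w ∈ Subgroup.closure S) : f.1 w = 0 := by
  have hcl : Subgroup.closure S ≤ fixingSubgroup G {v : M | (2 : ℤ) • v = 0} :=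
    (Subgroup.closure_le _).2 hSV
  induction hw using Subgroup.closure_induction with
  | mem x hx => exact hS x hx
  | one =>
    have h := cocyclesVanishingOn.cocycle f (1 : G) 1
    rw [mul_one, one_smul, left_eq_add] at h
    exact h
  | mul x y hx hy ihx ihy =>
    rw [apply_mul_of_mem_fixingSubgroup f hfV (hcl hx), ihx, ihy, add_zero]
  | inv x hx ihx =>
    have h : f.1 (x⁻¹ * x) = f.1 x⁻¹ + f.1 x :=
      apply_mul_of_mem_fixingSubgroup f hfV ((fixingSubgroup G _).inv_mem (hcl hx)) x
    rw [inv_mul_cancel, ihx, add_zero] at h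
    have h1 := cocyclesVanishingOn.cocycle f (1 : G) 1
    rw [mul_one, one_smul, left_eq_add] at h1
    exact h.symm.trans h1 ▸ rfl

/-! #### Step 3: the four-element group `V = M[2]` with two transvections and a swap -/

/-- With `t E₁ = E₁`, `t E₂ = E₁ + E₂` on `V = {0, E₁, E₂, E₁ + E₂}`: the fixed vectors of `t` in `V`
are `0, E₁` (the transvection computation behind `H¹(G, E[2]) = 0`).
[cite: LawsonWuthrich2016, §5 (H¹(⟨h⟩, E[2]) for a transvection h)] -/
theorem eq_zero_or_eq_of_smul_eq {E₁ E₂ : M} (h2E₁ : (2 : ℤ) • E₁ = 0) (hE₁ : E₁ ≠ 0)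
    (hV : ∀ v : M, (2 : ℤ) • v = 0 → v = 0 ∨ v = E₁ ∨ v = E₂ ∨ v = E₁ + E₂)
    {t : G} (ht₁ : t • E₁ = E₁) (ht₂ : t • E₂ = E₁ + E₂) {v : M} (hv : (2 : ℤ) • v = 0)
    (htv : t • v = v) : v = 0 ∨ v = E₁ := by
  have h11 : E₁ + E₁ = 0 := by rw [← two_zsmul, h2E₁]
  rcases hV v hv with h | h | h | h
  · exact Or.inl h
  · exact Or.inr h
  · exfalso; apply hE₁
    rw [h, ht₂] at htv
    -- `htv : E₁ + E₂ = E₂`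
    exact add_eq_right.1 htv
  · exfalso; apply hE₁
    rw [h, smul_add, ht₁, ht₂, ← add_assoc, h11, zero_add] at htv
    -- `htv : E₂ = E₁ + E₂`
    exact (add_eq_right.1 htv.symm)

/-- `t²` fixes `V` (`t² E₂ = E₂ + 2E₁ = E₂`): the square of a transvection of `𝔽₂²` is trivial.
[cite: LawsonWuthrich2016, §5 (H¹(⟨h⟩, E[2]) for a transvection h)] -/
theorem mul_self_mem_fixingSubgroup {E₁ E₂ : M} (h2E₁ : (2 : ℤ) • E₁ = 0)
    (hV : ∀ v : M, (2 : ℤ) • v = 0 → v = 0 ∨ v = E₁ ∨ v = E₂ ∨ v = E₁ + E₂)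
    {t : G} (ht₁ : t • E₁ = E₁) (ht₂ : t • E₂ = E₁ + E₂) :
    t * t ∈ fixingSubgroup G {v : M | (2 : ℤ) • v = 0} := by
  have h11 : E₁ + E₁ = 0 := by rw [← two_zsmul, h2E₁]
  have htt₂ : (t * t) • E₂ = E₂ := by
    rw [mul_smul, ht₂, smul_add, ht₁, ht₂, ← add_assoc, h11, zero_add]
  have htt₁ : (t * t) • E₁ = E₁ := by rw [mul_smul, ht₁, ht₁]
  refine (mem_fixingSubgroup_iff G).2 fun v hv ↦ ?_
  rcases hV v hv with h | h | h | h
  · rw [h]; exact smul_zero _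
  · rw [h]; exact htt₁
  · rw [h]; exact htt₂
  · rw [h, smul_add, htt₁, htt₂]

/-! #### Step 4: vanishing on the stabiliser from ONE value -/

/-- Powers of an element of `G_V` killed by `f` are killed by `f`. [folklore] -/
private theorem apply_zpow_eq_zero (f : cocyclesVanishingOn M N) (hfV : ∀ g, (2 : ℤ) • f.1 g = 0)
    {x : G} (hx : x ∈ fixingSubgroup G {v : M | (2 : ℤ) • v = 0}) (hx0 : f.1 x = 0) (m : ℤ) :
    f.1 (x ^ m) = 0 :=
  apply_eq_zero_of_mem_closure f hfV (S := {x}) (Set.singleton_subset_iff.2 hx)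
    (fun a ha ↦ by rw [Set.mem_singleton_iff.1 ha]; exact hx0)
    (Subgroup.zpow_mem _ (Subgroup.subset_closure (Set.mem_singleton x)) m)

/-- `f (t'²) = s • f (t²)` when `s t s⁻¹ ≡ t' (mod N)` and `t² ∈ G_V`; so `f(t²) = 0 ⇒ f(t'²) = 0`.
[folklore] -/
private theorem apply_mul_self_eq_zero_of_conj [N.Normal] (f : cocyclesVanishingOn M N)
    (hfV : ∀ g, (2 : ℤ) • f.1 g = 0)
    {t t' s : G} (htt : t * t ∈ fixingSubgroup G {v : M | (2 : ℤ) • v = 0})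
    (hst : ∃ n ∈ N, s * t * s⁻¹ = t' * n) (hu : f.1 (t * t) = 0) : f.1 (t' * t') = 0 := by
  obtain ⟨n, hn, hs⟩ := hst
  have e1 : s * (t * t) * s⁻¹ = (s * t * s⁻¹) * (s * t * s⁻¹) := by group
  have e2 : t' * n * (t' * n) = t' * t' * (t'⁻¹ * n * t' * n) := by group
  have hmem : t'⁻¹ * n * t' * n ∈ N :=
    N.mul_mem (Subgroup.Normal.conj_mem' inferInstance n hn t') hn
  have h := apply_conj_of_mem_fixingSubgroup f hfV htt s
  rw [hu, smul_zero, e1, hs, e2, cocyclesVanishingOn.apply_mul_of_mem f _ hmem] at h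
  exact h

/-- **`f(dᵢ) = 0`** for a "diagonal" element: `dᵢ ∈ G_V` with `t dᵢ t⁻¹ ≡ dᵢ (t²)^m` and
`t' dᵢ t'⁻¹ ≡ dᵢ (t'²)^{m'}` modulo `N`, when `f(t²) = f(t'²) = 0`: equivariance gives
`t • f(dᵢ) = f(dᵢ) = t' • f(dᵢ)`, and `ker(t − 1) ∩ ker(t' − 1) = 0` on `V`.
[cite: LawsonWuthrich2016, Lemma 3, §7.1] -/
private theorem apply_eq_zero_of_conj_rel (f : cocyclesVanishingOn M N) (hfV : ∀ g, (2 : ℤ) • f.1 g = 0)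
    {E₁ E₂ : M} (h2E₁ : (2 : ℤ) • E₁ = 0) (hE₁ : E₁ ≠ 0) (hE₂ : E₂ ≠ 0)
    (hV : ∀ v : M, (2 : ℤ) • v = 0 → v = 0 ∨ v = E₁ ∨ v = E₂ ∨ v = E₁ + E₂)
    {t t' : G} (ht₁ : t • E₁ = E₁) (ht₂ : t • E₂ = E₁ + E₂) (ht'₁ : t' • E₁ = E₁ + E₂)
    (htt : t * t ∈ fixingSubgroup G {v : M | (2 : ℤ) • v = 0})
    (ht't' : t' * t' ∈ fixingSubgroup G {v : M | (2 : ℤ) • v = 0})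
    (hu : f.1 (t * t) = 0) (hl : f.1 (t' * t') = 0)
    {x : G} (hxV : x ∈ fixingSubgroup G {v : M | (2 : ℤ) • v = 0})
    (hxt : ∃ (m : ℤ), ∃ n ∈ N, t * x * t⁻¹ = x * (t * t) ^ m * n)
    (hxt' : ∃ (m : ℤ), ∃ n ∈ N, t' * x * t'⁻¹ = x * (t' * t') ^ m * n) :
    f.1 x = 0 := by
  have h1 : t • f.1 x = f.1 x := by
    obtain ⟨m, n, hn, hrel⟩ := hxt
    rw [← apply_conj_of_mem_fixingSubgroup f hfV hxV t, hrel,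
      cocyclesVanishingOn.apply_mul_of_mem f _ hn, apply_mul_of_mem_fixingSubgroup f hfV hxV,
      apply_zpow_eq_zero f hfV htt hu m, add_zero]
  have h2 : t' • f.1 x = f.1 x := by
    obtain ⟨m, n, hn, hrel⟩ := hxt'
    rw [← apply_conj_of_mem_fixingSubgroup f hfV hxV t', hrel,
      cocyclesVanishingOn.apply_mul_of_mem f _ hn, apply_mul_of_mem_fixingSubgroup f hfV hxV,
      apply_zpow_eq_zero f hfV ht't' hl m, add_zero]
  rcases eq_zero_or_eq_of_smul_eq h2E₁ hE₁ hV ht₁ ht₂ (hfV x) h1 with h0 | h0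
  · exact h0
  · exfalso; apply hE₂
    rw [h0, ht'₁] at h2
    -- `h2 : E₁ + E₂ = E₁`
    exact add_eq_left.1 h2

/-- **Vanishing on `G_V` from `f(t²) = 0`.** Hypotheses (the `GL₂(ℤ/2^k)` features): `V = M[2]` is
`{0, E₁, E₂, E₁ + E₂}` with `E₁, E₂ ≠ 0`; `t, t'` act on `V` as the two standard transvections;
`s t s⁻¹ ≡ t' (mod N)`; a family `d` of elements of `G_V` with `t dᵢ t⁻¹ ≡ dᵢ (t²)^m`,
`t' dᵢ t'⁻¹ ≡ dᵢ (t'²)^{m'} (mod N)`; and `G_V ⊆ ⟨t², t'², d⟩ · N`.  Then an `M[2]`-valued crossed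
homomorphism `f` vanishing on `N` with `f(t²) = 0` vanishes on all of `G_V`.
[cite: LawsonWuthrich2016, Lemma 3, §7.1] [cite: Sah1968, Prop. 2.7 (b)] -/
theorem apply_eq_zero_of_mem_fixingSubgroup_of_apply_mul_self_eq_zero [N.Normal]
    (f : cocyclesVanishingOn M N) (hfV : ∀ g, (2 : ℤ) • f.1 g = 0)
    {E₁ E₂ : M} (h2E₁ : (2 : ℤ) • E₁ = 0) (h2E₂ : (2 : ℤ) • E₂ = 0) (hE₁ : E₁ ≠ 0) (hE₂ : E₂ ≠ 0)
    (hV : ∀ v : M, (2 : ℤ) • v = 0 → v = 0 ∨ v = E₁ ∨ v = E₂ ∨ v = E₁ + E₂)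
    {t t' s : G} (ht₁ : t • E₁ = E₁) (ht₂ : t • E₂ = E₁ + E₂) (ht'₁ : t' • E₁ = E₁ + E₂)
    (ht'₂ : t' • E₂ = E₂) (hst : ∃ n ∈ N, s * t * s⁻¹ = t' * n)
    {ι : Type*} (d : ι → G) (hdV : ∀ i, d i ∈ fixingSubgroup G {v : M | (2 : ℤ) • v = 0})
    (hdt : ∀ i, ∃ (m : ℤ), ∃ n ∈ N, t * d i * t⁻¹ = d i * (t * t) ^ m * n)
    (hdt' : ∀ i, ∃ (m : ℤ), ∃ n ∈ N, t' * d i * t'⁻¹ = d i * (t' * t') ^ m * n)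
    (hgen : ∀ g ∈ fixingSubgroup G {v : M | (2 : ℤ) • v = 0},
      ∃ w ∈ Subgroup.closure ({t * t, t' * t'} ∪ Set.range d), ∃ n ∈ N, g = w * n)
    (hu : f.1 (t * t) = 0) :
    ∀ g ∈ fixingSubgroup G {v : M | (2 : ℤ) • v = 0}, f.1 g = 0 := by
  have h22 : E₂ + E₂ = 0 := by rw [← two_zsmul, h2E₂]
  have htt : t * t ∈ fixingSubgroup G {v : M | (2 : ℤ) • v = 0} :=
    mul_self_mem_fixingSubgroup h2E₁ hV ht₁ ht₂
  have hV' : ∀ v : M, (2 : ℤ) • v = 0 → v = 0 ∨ v = E₂ ∨ v = E₁ ∨ v = E₂ + E₁ := fun v hv ↦ by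
    rcases hV v hv with h | h | h | h
    · exact Or.inl h
    · exact Or.inr (Or.inr (Or.inl h))
    · exact Or.inr (Or.inl h)
    · exact Or.inr (Or.inr (Or.inr (h.trans (add_comm _ _))))
  have ht't' : t' * t' ∈ fixingSubgroup G {v : M | (2 : ℤ) • v = 0} :=
    mul_self_mem_fixingSubgroup h2E₂ hV' ht'₂ (by rw [ht'₁, add_comm])
  have hl : f.1 (t' * t') = 0 := apply_mul_self_eq_zero_of_conj f hfV htt hst hu
  have hd : ∀ i, f.1 (d i) = 0 := fun i ↦
    apply_eq_zero_of_conj_rel f hfV h2E₁ hE₁ hE₂ hV ht₁ ht₂ ht'₁ htt ht't' hu hl (hdV i) (hdt i)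
      (hdt' i)
  have hSV : ({t * t, t' * t'} ∪ Set.range d) ⊆ (fixingSubgroup G {v : M | (2 : ℤ) • v = 0} : Set G) := by
    rintro x (hx | ⟨i, rfl⟩)
    · rcases hx with rfl | rfl
      · exact htt
      · exact ht't'
    · exact hdV i
  have hS0 : ∀ x ∈ ({t * t, t' * t'} ∪ Set.range d), f.1 x = 0 := by
    rintro x (hx | ⟨i, rfl⟩)
    · rcases hx with rfl | rfl
      · exact hu
      · exact hl
    · exact hd i
  intro g hg
  obtain ⟨w, hw, n, hn, rfl⟩ := hgen g hg
  rw [cocyclesVanishingOn.apply_mul_of_mem f _ hn]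
  exact apply_eq_zero_of_mem_closure f hfV hSV hS0 hw

end OrderTwoAlgebra

end Rubin1987

end Literature.NumberTheory.EllipticCurves

end
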